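import Summits.BirchSwinnertonDyer.BirchSwinnertonDyer.Theorems.ByReductionTypeAtTwoRankOneAtTwoOneDoorLawFirstLayerDefs
import Summits.BirchSwinnertonDyer.BirchSwinnertonDyer.Theorems.ByReductionTypeAtTwoRankOneAtTwoBigImageOddLocalOneDoorSubslicePosDisc
import Summits.BirchSwinnertonDyer.BirchSwinnertonDyer.Theorems.ByReductionTypeAtTwoRankOneAtTwoBigImageOddLocalOneDoorSubsliceNegDiscTwoConverse
import Summits.BirchSwinnertonDyer.BirchSwinnertonDyer.Theorems.GenusKolyvaginAtTwoGenusPrimitiveSupplyAtTwoArchimedeanRowsHold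
import HarnessLib

/-!
# Route ByReductionTypeAtTwo, crux `RankOneAtTwoBigImageOddLocal` (stmt-BirchSwinnertonDyer-23715), LINE v8.17 `one_door_analytic`:
# THE FIRST LAYER MADE SIGN-FREE — R₀ `HeegnerNonDivisibilityAtSelmerTrivialMinimalDoorAtTwo` replaces the pair (R⁻₀, AN-13)

Lead prover seat `bsd-line-fkl-p1` g16 (2026-08-28), `--supports stmt-BirchSwinnertonDyer-23715` (helper).  THEOREMS ONLY; no definition, no named
fact introduced, no `sorry`; every `BSD₂` statement is CONDITIONAL on PRINT named facts of the tree (Gross–Zagier, Kolyvagin, modularity,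
Hoffstein–Luo, Gross 1991 Prop. 3.7 (2)) and on the registered residues, displayed as hypotheses.  BSD is not proved by any of this.

LINE v8.16 carried the first Kolyvagin layer of the crux as TWO conjecture-grade stubs split by the sign of the discriminant: R⁻₀
`HeegnerNonDivisibilityAtSelmerTrivialPrimeDoorAtTwo` (`Δ_W < 0`: non-divisibility at a `Sel₂`-trivial transposition-prime door) and -an's AN-13
`F1Sign2.HeegnerPointOnEggAtTwo` (`Δ_W > 0`: the Heegner point of an egg curve is rational-on-the-egg up to torsion).  Two TREE theorems make the
sign split unnecessary: route GenusKolyvaginAtTwo's PROVED egg twist law `GenusKolyArch.eggTwistLawAtTwo_holds` (Kramer 1981 Prop. 6: every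
desc-admissible twin of a rank-one `Ш[2] = 0` egg curve has `#Sel₂ = 1`), which turns the silent-prime Heegner field of
`GenusKolyTwin.exists_silent_prime_heegnerField` into a `Sel₂`-TRIVIAL MINIMAL door at `Δ_W > 0` exactly as gk2-p4's
`exists_transpAdmissible_door_twistSelmerTwoCard_eq_one` does at `Δ_W < 0`; and the egg lemma / AN-34n dictionary, by which AN-13 on its class is
«exponent `0`».  So ONE sign-free statement — R₀ `HeegnerNonDivisibilityAtSelmerTrivialMinimalDoorAtTwo` (`Theorems/…OneDoorLawFirstLayerDefs.lean`:
Kolyvagin's conjecture at `2`, W. Zhang 2014 Thm. 1.1 at `p = 2` in its `Sel₂`-rank-one instance, at EVERY `Sel₂`-trivial minimal door) — does the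
work of both:

* §1 `heegnerNonDivisibilityAtSelmerTrivialPrimeDoorAtTwo_of_minimalDoor` — R₀ ⟹ R⁻₀ verbatim (a transposition-admissible door is door-admissible
  and minimal);
* §2 **`hasBottomRungDoorAtTwo_of_kolyvaginTwo_posDisc`** — R₀ puts the egg class {`Δ_W > 0`, `Ш(W)[2] = 0`, `MeetsEgg W`, odd-constant datum} on the
  proved sub-slice WITHOUT AN-13 (door by `exists_silent_prime_heegnerField` beyond `N_W`, hence coprime to `N_W`; `#Sel₂(W^{(d_K)}) = 1` by the egg twist
  law; exponent `0` by R₀; the door opens itself by Gross–Zagier); `class_hasBottomRungDoorAtTwo_of_kolyvaginTwo` — both classes at once;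
* §3 **`rankOneAtTwoBigImageOddLocal_of_kolyvaginTwo_of_residuePlusPlus`** — the v8.17 COMPOSITION: PRINT⁵ + R₀ + R₊₊ + the four rank-`0` cruxes ⟹
  the crux BY NAME (R₊ from R₊₊ and §2 by the lead's APPEND #11 case split, then v8.15's composition with §1);
* §4 LOSSLESS modulo the rank-`0` `2`-converse, BOTH SIGNS: `hasTwoDivisibilityUpToTorsion_zero_of_bsdp_two_at_minimalDoor` (g15's transposition-door
  theorem at ANY minimal door: `2m + [Δ<0] = 0 + 0 + (t + 2s) + 0` and `t + 2s = [Δ<0]` give `m = 0`), `kolyvaginTwo_of_bsdTwo_on_class_of_twoConverse`,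
  **`kolyvaginTwo_of_rankOneAtTwoBigImageOddLocal_of_twoConverse`** (R₀ FROM THE CRUX), `kolyvaginTwo_and_residuePlusPlus_of_rankOneAtTwoBigImageOddLocal_of_twoConverse`
  (crux ⟺ R₀ ∧ R₊₊ modulo PRINT⁵ + rank-`0` cruxes + the rank-`0` `2`-converse).

References: [Zhang2014CJM] Thm. 1.1 (shape, p ≥ 5); [GrossLMS1991] Conj. 1.2, §3, §10, Prop. 3.7 (2); [Kolyvagin1990] Thm. A; [GrossZagier1986]
Thm. I.6.3, V.§2; [Kramer1981] Prop. 3, Prop. 6; [MazurRubin2010] Prop. 3.3, Cor. 3.4 (i); [BhargavaSkinnerZhang2014] Thm. 5 (d).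
-/

set_option autoImplicit false
-- the Theorems namespace of this sub repeats the summit name by design (D-0017 nested layout)
set_option linter.dupNamespace false

noncomputable section

open scoped Classical

namespace Summit.BirchSwinnertonDyer.BirchSwinnertonDyer.Theorems.RankOneAtTwoOneDoor

open WeierstrassCurve NumberField Literature.NumberTheory.EllipticCurves Literature.NumberTheory.EllipticCurves.ModularForms
  Summit.BirchSwinnertonDyer.Rank1Residual.F1Sign2
  Summit.BirchSwinnertonDyer.Rank1Residual.F1Sign2.TranspositionDoor
  Summit.BirchSwinnertonDyer.BirchSwinnertonDyer.Theses.ByReductionTypeAtTwo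
open Summit.BirchSwinnertonDyer.BirchSwinnertonDyer.Theorems.GenusKolyTwin (exists_silent_prime_heegnerField)
open Summit.BirchSwinnertonDyer.BirchSwinnertonDyer.Theorems.GenusKolyArch (eggTwistLawAtTwo_holds)

/-! ### §1 R₀ ⟹ R⁻₀ -/

/-- **R₀ IMPLIES R⁻₀ VERBATIM.**  A transposition-admissible door `(d_K, q₀)` at `Δ_W < 0` is door-admissible
(`ANg16.doorAdmissible_of_transpAdmissible`) and minimal (`t = 1`, `s = 0`: `minimal_of_transpAdmissible`), so R₀ applies; R⁻₀'s hypothesis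
`MeetsNonNormAt W q₀` is not used (under `#Sel₂(W^{(d_K)}) = 1` it is automatic by the transposition twist law, but nothing here needs that).
[cite: Zhang2014CJM, Thm. 1.1 (shape; nothing asserted at 2)] [cite: GrossLMS1991, Conj. 1.2 and §10] [cite: MazurRubin2010, Prop. 3.3] -/
theorem heegnerNonDivisibilityAtSelmerTrivialPrimeDoorAtTwo_of_minimalDoor (h : HeegnerNonDivisibilityAtSelmerTrivialMinimalDoorAtTwo) :
    HeegnerNonDivisibilityAtSelmerTrivialPrimeDoorAtTwo := by
  intro W _ _ _ hCM hsurj hT hc hr hΔ hSha K _ _ hK q₀ _ htr _hnn hcop hHN hsel Dt H ι P hP hodd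
  exact h W hCM hsurj hT hc hr hSha K hK (ANg16.doorAdmissible_of_transpAdmissible W htr) (minimal_of_transpAdmissible W htr hΔ) hcop hHN
    hsel Dt H ι P hP hodd

/-! ### §2 R₀ puts the egg class on the proved sub-slice (no AN-13) -/

/-- **UNDER R₀, EVERY CURVE OF THE SLICE WITH `Δ_W > 0`, `Ш(W)[2] = 0`, `E(ℚ)` MEETING THE EGG AND AN ODD-CONSTANT PARAMETRISATION DATUM ADMITS A
BOTTOM-RUNG DOOR DATUM** — the width seat fkl-p2 g13's class theorem `hasBottomRungDoorAtTwo_of_heegnerPointOnEggAtTwo` with -an's AN-13 REPLACED by the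
sign-free R₀.  The door: route GenusKolyvaginAtTwo's Čebotarev theorem `GenusKolyTwin.exists_silent_prime_heegnerField` gives a silent prime `ℓ > N_W`
(so `(d_K, N_W) = 1`) with `K = ℚ(√−ℓ)` imaginary quadratic, `d_K = −ℓ` DESC-admissible — hence door-admissible (`ANg16.doorAdmissible_of_descAdmissible`) and
MINIMAL (`t = s = 0`, `minimal_of_descAdmissible_of_pos`) — and the Heegner hypothesis; the twin is `Sel₂`-TRIVIAL by the PROVED egg twist law
`GenusKolyArch.eggTwistLawAtTwo_holds` (`rank E(ℚ) = 1` from Gross–Zagier + Kolyvagin + modularity + Hoffstein–Luo, `E(ℚ)[2] = 0` from odd torsion order,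
`Ш(W)[2] = 0`, `MeetsEgg W`); over `K` the GIVEN odd-constant datum has a Heegner datum and a `K`-rational Heegner point
(`heegnerPointComplex_mem_range_map_holds`); R₀ gives exponent `0`; the door opens itself (`twist_entireLFunction_ne_zero_of_hasTwoDivisibilityUpToTorsion_zero`,
Gross–Zagier); a globally minimal model of the twist exists.  CONDITIONAL on R₀ and on Gross–Zagier, Kolyvagin, modularity, Hoffstein–Luo; BSD is not proved
by this. [cite: Zhang2014CJM, Thm. 1.1 (p ≥ 5 analogue; nothing asserted at 2)] [cite: Kramer1981, Prop. 6] [cite: GrossZagier1986, Thm. I.6.3 and V.§2]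
[cite: GrossLMS1991, §10] -/
theorem hasBottomRungDoorAtTwo_of_kolyvaginTwo_posDisc (h : HeegnerNonDivisibilityAtSelmerTrivialMinimalDoorAtTwo)
    (hGZ : ∀ (N : ℕ) [NeZero N] (W : WeierstrassCurve ℚ) (K : Type) [Field K] [NumberField K], gross_zagier N W K)
    (hKo : ∀ (N : ℕ) [NeZero N] (W : WeierstrassCurve ℚ) (K : Type) [Field K] [NumberField K], kolyvagin N W K)
    (hnf : exists_isNewformOf) (hHL : HoffsteinLuo1997_exists_twist_L_one_ne_zero)
    (W : WeierstrassCurve ℚ) [W.IsElliptic] [W.IsGloballyMinimal] [NeZero (W.conductorNorm ℤ)]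
    (hCM : ¬ W.HasCM) (hsurj : ∀ n : ℕ, W.HasSurjectiveModNGaloisRep ((2 ^ n : ℕ) : ℤ)) (hT : Odd W.torsionOrder)
    (hc : Odd W.tamagawaProduct) (hr : W.analyticRank = 1) (hΔ : 0 < W.Δ) (hSha : ShaTwoTrivial W) (hmeets : MeetsEgg W)
    (Dt : ModularParametrizationData W (W.conductorNorm ℤ)) (hodd : Odd Dt.c) : HasBottomRungDoorAtTwo W := by
  -- the door: a silent prime `ℓ > N_W`, `K = ℚ(√-ℓ)`, `d_K = -ℓ` desc-admissible, Heegner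
  have hsurj2 : W.HasSurjectiveModNGaloisRep 2 := by simpa using hsurj 1
  obtain ⟨ℓ, hNℓ, hℓ, -, -, -, hDA, -, K, iF, iN, hK, hd, -, -, hHN, -, -, -⟩ :=
    exists_silent_prime_heegnerField W hΔ hsurj2 (W.conductorNorm ℤ)
  rw [← hd] at hDA
  have hadm : DoorAdmissible W (NumberField.discr K) := ANg16.doorAdmissible_of_descAdmissible W hDA
  have hmin : transpCount W (NumberField.discr K) + 2 * identCount W (NumberField.discr K) = (if W.Δ < 0 then 1 else 0) :=
    minimal_of_descAdmissible_of_pos W hΔ hDA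
  -- `(d_K, N_W) = 1`: `|d_K| = ℓ` is a prime beyond `N_W`
  have hcop : Nat.Coprime (NumberField.discr K).natAbs (W.conductorNorm ℤ) := by
    rw [hd, Int.natAbs_neg, Int.natAbs_natCast]
    refine (Nat.Prime.coprime_iff_not_dvd hℓ).mpr fun hdvd => ?_
    exact absurd (Nat.le_of_dvd (Nat.pos_of_ne_zero (NeZero.ne _)) hdvd) (not_le.mpr hNℓ)
  -- the Heegner datum, an embedding, the `K`-rational point over the complex Heegner point of the GIVEN datum `Dt`
  obtain ⟨H, -⟩ :=
    nonempty_heegnerDatum_holds (W.conductorNorm ℤ) K hK (exists_dvd_sq_sub_discr_holds (W.conductorNorm ℤ) K hK hHN).choose_spec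
  obtain ⟨ι⟩ : Nonempty (K →+* ℂ) := inferInstance
  obtain ⟨P, hP⟩ := heegnerPointComplex_mem_range_map_holds (W.conductorNorm ℤ) W K hK hHN Dt H ι
  -- the twin is `Sel₂`-trivial: the PROVED egg twist law (Kramer 1981 Prop. 6) on a rank-one `Ш[2] = 0` egg curve
  have hrk : W.mordellWeilRank = 1 := (mordellWeilRank_eq_one_of_analyticRank_eq_one_of_isGloballyMinimal hGZ hKo hnf hHL W hr).1
  have hT2 : NoRationalTwoTorsion W := noRationalTwoTorsion_of_odd_torsionOrder W hT
  have hsel : twistSelmerTwoCard W (NumberField.discr K) = 1 :=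
    (eggTwistLawAtTwo_holds W hΔ hT2 hrk hSha (NumberField.discr K) hDA).1 hmeets
  -- R₀: exponent `0`
  have hm0 : HasTwoDivisibilityUpToTorsion W K P 0 :=
    h W hCM hsurj hT hc hr hSha K hK hadm hmin hcop hHN hsel Dt H ι P hP hodd
  -- the door opens itself: `L(W^{(d_K)}, 1) ≠ 0` (Gross–Zagier + modularity)
  have hLt : (W.quadraticTwist (NumberField.discr K : ℚ)).entireLFunction 1 ≠ 0 :=
    twist_entireLFunction_ne_zero_of_hasTwoDivisibilityUpToTorsion_zero hnf W hr K hK (hGZ _ W K) hHN Dt H ι P hP hm0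
  -- a globally minimal model of the twist
  have hD0 : (NumberField.discr K : ℚ) ≠ 0 := by exact_mod_cast NumberField.discr_ne_zero K
  haveI hEt : (W.quadraticTwist (NumberField.discr K : ℚ)).IsElliptic := W.isElliptic_quadraticTwist hD0
  obtain ⟨Cd, hCd⟩ := hasGlobalMinimalModel_rat_holds (W.quadraticTwist (NumberField.discr K : ℚ))
  unfold HasBottomRungDoorAtTwo
  exact ⟨K, iF, iN, hK, hadm, hLt, hmin, Dt, H, ι, P, Cd • W.quadraticTwist (NumberField.discr K : ℚ), inferInstance, hCd, Cd, hP, rfl,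
    hodd, hm0⟩

/-- **UNDER R₀ BOTH FIRST-LAYER CLASSES LIE ON THE PROVED SUB-SLICE**: every curve of the slice with `Ш(W)[2] = 0`, an odd-constant datum, and
(`Δ_W < 0`, or `Δ_W > 0` with `E(ℚ)` meeting the egg) admits a bottom-rung door datum — §1 + the lead's `hasBottomRungDoorAtTwo_of_heegnerNonDivisibility`
(gk2-p4's transposition supply) at `Δ_W < 0`, §2 at `Δ_W > 0`.  CONDITIONAL on R₀ and the four primary printed facts; BSD is not proved by this.
[cite: Zhang2014CJM, Thm. 1.1] [cite: MazurRubin2010, Prop. 3.3] [cite: Kramer1981, Prop. 6] -/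
theorem class_hasBottomRungDoorAtTwo_of_kolyvaginTwo (h : HeegnerNonDivisibilityAtSelmerTrivialMinimalDoorAtTwo)
    (hGZ : ∀ (N : ℕ) [NeZero N] (W : WeierstrassCurve ℚ) (K : Type) [Field K] [NumberField K], gross_zagier N W K)
    (hKo : ∀ (N : ℕ) [NeZero N] (W : WeierstrassCurve ℚ) (K : Type) [Field K] [NumberField K], kolyvagin N W K)
    (hnf : exists_isNewformOf) (hHL : HoffsteinLuo1997_exists_twist_L_one_ne_zero)
    (W : WeierstrassCurve ℚ) [W.IsElliptic] [W.IsGloballyMinimal] [NeZero (W.conductorNorm ℤ)]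
    (hCM : ¬ W.HasCM) (hsurj : ∀ n : ℕ, W.HasSurjectiveModNGaloisRep ((2 ^ n : ℕ) : ℤ)) (hT : Odd W.torsionOrder)
    (hc : Odd W.tamagawaProduct) (hr : W.analyticRank = 1) (hSha : ShaTwoTrivial W) (hsign : W.Δ < 0 ∨ (0 < W.Δ ∧ MeetsEgg W))
    (Dt : ModularParametrizationData W (W.conductorNorm ℤ)) (hodd : Odd Dt.c) : HasBottomRungDoorAtTwo W := by
  rcases hsign with hΔ | ⟨hΔ, hmeets⟩
  · exact hasBottomRungDoorAtTwo_of_heegnerNonDivisibility hGZ hKo hnf hHL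
      (heegnerNonDivisibilityAtSelmerTrivialPrimeDoorAtTwo_of_minimalDoor h) W hCM hsurj hT hc hr hΔ hSha Dt hodd
  · exact hasBottomRungDoorAtTwo_of_kolyvaginTwo_posDisc h hGZ hKo hnf hHL W hCM hsurj hT hc hr hΔ hSha hmeets Dt hodd

/-- **`BSDp W 2` ON BOTH FIRST-LAYER CLASSES FROM R₀**, modulo the five printed facts and the route's four rank-`0` cruxes at `2` BY NAME: the class theorem
puts `W` on the proved sub-slice, where U₀ from print makes the datum lawful (`hasLawfulDoorAtTwo_of_hasBottomRungDoorAtTwo_of_print`) and one lawful datum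
gives `BSD₂(W)` (`bsdp_two_of_hasLawfulDoorAtTwo_of_rankZero_cruxes`).  The sign-free union of the lead's `bsdp_two_of_heegnerNonDivisibility_negDisc` and the
width seat's `bsdp_two_of_heegnerPointOnEggAtTwo_posDisc`.  CONDITIONAL by design; BSD is not proved by this. [cite: Zhang2014CJM, Thm. 1.1]
[cite: GrossLMS1991, §10 and Prop. 3.7 (2)] [cite: Kolyvagin1990, Thm. A] [cite: GrossZagier1986, Thm. I.6.3 and V.§2] -/
theorem bsdp_two_of_kolyvaginTwo_firstLayer (h : HeegnerNonDivisibilityAtSelmerTrivialMinimalDoorAtTwo)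
    (hGZ : ∀ (N : ℕ) [NeZero N] (W : WeierstrassCurve ℚ) (K : Type) [Field K] [NumberField K], gross_zagier N W K)
    (hKo : ∀ (N : ℕ) [NeZero N] (W : WeierstrassCurve ℚ) (K : Type) [Field K] [NumberField K], kolyvagin N W K)
    (hnf : exists_isNewformOf) (hHL : HoffsteinLuo1997_exists_twist_L_one_ne_zero)
    (h37 : Literature.NumberTheory.EllipticCurves.GrossLMS1991.prop37_2_frobeniusCongruence)
    (hZ4 : GoodOrdinaryRankZeroAtTwo ∧ MultiplicativeRankZeroAtTwo ∧ SupersingularRankZeroAtTwo ∧ AdditiveRankZeroAtTwo)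
    (W : WeierstrassCurve ℚ) [W.IsElliptic] [W.IsGloballyMinimal] [NeZero (W.conductorNorm ℤ)]
    (hCM : ¬ W.HasCM) (hsurj : ∀ n : ℕ, W.HasSurjectiveModNGaloisRep ((2 ^ n : ℕ) : ℤ)) (hT : Odd W.torsionOrder)
    (hc : Odd W.tamagawaProduct) (hr : W.analyticRank = 1) (hSha : ShaTwoTrivial W) (hsign : W.Δ < 0 ∨ (0 < W.Δ ∧ MeetsEgg W))
    (Dt : ModularParametrizationData W (W.conductorNorm ℤ)) (hodd : Odd Dt.c) : BSDp W 2 :=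
  bsdp_two_of_hasLawfulDoorAtTwo_of_rankZero_cruxes hGZ hKo hnf hHL hZ4 W hCM hT hc hr
    (hasLawfulDoorAtTwo_of_hasBottomRungDoorAtTwo_of_print hGZ hKo hnf hHL h37 W hCM hsurj hT hc hr
      (class_hasBottomRungDoorAtTwo_of_kolyvaginTwo h hGZ hKo hnf hHL W hCM hsurj hT hc hr hSha hsign Dt hodd))

/-! ### §3 The v8.17 composition: PRINT⁵ + R₀ + R₊₊ + the four rank-`0` cruxes ⟹ the crux BY NAME -/

/-- **R₀ ∧ R₊₊ ⟹ R₊** (modulo the four primary printed facts): §2 discharges the egg-class hypothesis of the lead's APPEND #11 case split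
`doorIndexLawFullCAtTwoSomeDoorResiduePlus_of_residuePlusPlus_of_eggClass`.  CONDITIONAL by design. [cite: GrossLMS1991, Conj. 1.2, §3 and §10]
[cite: Zhang2014CJM, Thm. 1.1] -/
theorem doorIndexLawFullCAtTwoSomeDoorResiduePlus_of_kolyvaginTwo_of_residuePlusPlus
    (hGZ : ∀ (N : ℕ) [NeZero N] (W : WeierstrassCurve ℚ) (K : Type) [Field K] [NumberField K], gross_zagier N W K)
    (hKo : ∀ (N : ℕ) [NeZero N] (W : WeierstrassCurve ℚ) (K : Type) [Field K] [NumberField K], kolyvagin N W K)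
    (hnf : exists_isNewformOf) (hHL : HoffsteinLuo1997_exists_twist_L_one_ne_zero)
    (h : HeegnerNonDivisibilityAtSelmerTrivialMinimalDoorAtTwo) (hPP : DoorIndexLawFullCAtTwoSomeDoorResiduePlusPlus) :
    DoorIndexLawFullCAtTwoSomeDoorResiduePlus :=
  doorIndexLawFullCAtTwoSomeDoorResiduePlus_of_residuePlusPlus_of_eggClass hPP
    fun W _ _ _ hCM hsurj hT hc hr hΔ hSha hmeets Dt hodd =>
      hasBottomRungDoorAtTwo_of_kolyvaginTwo_posDisc h hGZ hKo hnf hHL W hCM hsurj hT hc hr hΔ hSha hmeets Dt hodd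

/-- **THE v8.17 COMPOSITION — `RankOneAtTwoBigImageOddLocal` FROM FIVE PRINTED FACTS, R₀, R₊₊ AND THE ROUTE'S FOUR RANK-`0` CRUXES.**  R⁻₀ from R₀ (§1),
R₊ from R₀ ∧ R₊₊ (§2 + APPEND #11), then the lead's v8.15 composition `rankOneAtTwoBigImageOddLocal_of_heegnerNonDivisibility_of_residuePlus` (R⁻₀ puts the
`Δ_W < 0` class on the sub-slice; v8.14's case split on `HasBottomRungDoorAtTwo W`; U₀ from print; the per-datum kernel iff; twin `BSD₂` from the rank-`0`
cruxes).  The inputs displayed: Gross–Zagier, Kolyvagin, modularity, Hoffstein–Luo, Gross 1991 Prop. 3.7 (2) (PRINT); R₀ (Kolyvagin's conjecture at `2` at a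
`Sel₂`-trivial minimal door — CONJECTURE); R₊₊ (the ∀∃ residue off both first-layer classes — CONJECTURE); the four `…RankZeroAtTwo` cruxes (OPEN items).
CONDITIONAL by design; BSD is not proved by this. [cite: Zhang2014CJM, Thm. 1.1 (shape; p ≥ 5 in print)] [cite: GrossLMS1991, Conj. 1.2, §10 and Prop. 3.7 (2)]
[cite: Kolyvagin1990, Thm. A] [cite: GrossZagier1986, Thm. I.6.3 and V.§2] [cite: Kramer1981, Prop. 6] -/
theorem rankOneAtTwoBigImageOddLocal_of_kolyvaginTwo_of_residuePlusPlus
    (hGZ : ∀ (N : ℕ) [NeZero N] (W : WeierstrassCurve ℚ) (K : Type) [Field K] [NumberField K], gross_zagier N W K)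
    (hKo : ∀ (N : ℕ) [NeZero N] (W : WeierstrassCurve ℚ) (K : Type) [Field K] [NumberField K], kolyvagin N W K)
    (hnf : exists_isNewformOf) (hHL : HoffsteinLuo1997_exists_twist_L_one_ne_zero)
    (h37 : Literature.NumberTheory.EllipticCurves.GrossLMS1991.prop37_2_frobeniusCongruence)
    (h : HeegnerNonDivisibilityAtSelmerTrivialMinimalDoorAtTwo) (hPP : DoorIndexLawFullCAtTwoSomeDoorResiduePlusPlus)
    (hZ4 : GoodOrdinaryRankZeroAtTwo ∧ MultiplicativeRankZeroAtTwo ∧ SupersingularRankZeroAtTwo ∧ AdditiveRankZeroAtTwo) :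
    RankOneAtTwoBigImageOddLocal :=
  rankOneAtTwoBigImageOddLocal_of_heegnerNonDivisibility_of_residuePlus hGZ hKo hnf hHL h37
    (heegnerNonDivisibilityAtSelmerTrivialPrimeDoorAtTwo_of_minimalDoor h)
    (doorIndexLawFullCAtTwoSomeDoorResiduePlus_of_kolyvaginTwo_of_residuePlusPlus hGZ hKo hnf hHL h hPP) hZ4

/-! ### §4 Losslessness modulo the rank-`0` `2`-converse, both signs -/

/-- **`BSDp W 2 ⟹ y_K ∉ 2E(K) + E(K)_tors` AT ANY `Sel₂`-TRIVIAL MINIMAL DOOR WHOSE TWIN IS KNOWN** — g15's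
`hasTwoDivisibilityUpToTorsion_zero_of_bsdp_two_at_transpDoor` at an arbitrary minimal door-admissible door (either sign of `Δ_W`).  `W/ℚ` globally minimal,
odd torsion order, odd Tamagawa product, analytic rank `1`, `Ш(W)[2] = 0`, `BSDp W 2`; `K` imaginary quadratic with `d_K` door-admissible and the door
minimal, `#Sel₂(W^{(d_K)}) = 1`, the door NON-VANISHING; an odd-constant datum `Dt`, `H`, `ι`, `P`; a globally minimal model `Wd` of the twist with `BSDp Wd 2`.
THEN `HasTwoDivisibilityUpToTorsion W K P 0`: the per-datum kernel iff (`bsdp_two_iff_doorLawFullC_at_of_rank`) gives `m` with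
`2m + [Δ_W<0] = s_W + s_d + t + 2s + 2·v₂(c)`; `s_W = 0` (`Ш(W)[2] = 0`), `s_d = 0` (`twist_arith_of_selmerTrivial`), `t + 2s = [Δ_W<0]` (minimality), `c` odd;
so `m = 0`.  CONDITIONAL by design; BSD is not proved by this. [cite: Zhang2014CJM, Thm. 1.1] [cite: GrossZagier1986, Thm. I.6.3 and V.§2]
[cite: GrossLMS1991, Conj. 1.2 and §3] -/
theorem hasTwoDivisibilityUpToTorsion_zero_of_bsdp_two_at_minimalDoor
    (hGZ : ∀ (N : ℕ) [NeZero N] (W : WeierstrassCurve ℚ) (K : Type) [Field K] [NumberField K], gross_zagier N W K)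
    (hKo : ∀ (N : ℕ) [NeZero N] (W : WeierstrassCurve ℚ) (K : Type) [Field K] [NumberField K], kolyvagin N W K)
    (hnf : exists_isNewformOf) (hHL : HoffsteinLuo1997_exists_twist_L_one_ne_zero)
    (W : WeierstrassCurve ℚ) [W.IsElliptic] [W.IsGloballyMinimal] [NeZero (W.conductorNorm ℤ)]
    (hT : Odd W.torsionOrder) (hc : Odd W.tamagawaProduct) (hr : W.analyticRank = 1) (hSha : ShaTwoTrivial W) (hB : BSDp W 2)
    (K : Type) [Field K] [NumberField K] (hK : IsImaginaryQuadratic K) (hadm : DoorAdmissible W (NumberField.discr K))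
    (hmin : transpCount W (NumberField.discr K) + 2 * identCount W (NumberField.discr K) = (if W.Δ < 0 then 1 else 0))
    (hsel : twistSelmerTwoCard W (NumberField.discr K) = 1)
    (hLt : (W.quadraticTwist (NumberField.discr K : ℚ)).entireLFunction 1 ≠ 0)
    (Dt : ModularParametrizationData W (W.conductorNorm ℤ)) (H : HeegnerDatum (W.conductorNorm ℤ) (NumberField.discr K))
    (ι : K →+* ℂ) (P : (W.baseChange K).toAffine.Point)
    (hP : WeierstrassCurve.Affine.Point.map ι.toRatAlgHom P = heegnerPointComplex Dt H) (hodd : Odd Dt.c)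
    (Wd : WeierstrassCurve ℚ) [Wd.IsElliptic] [Wd.IsGloballyMinimal] (Cd : WeierstrassCurve.VariableChange ℚ)
    (hWd : Cd • W.quadraticTwist (NumberField.discr K : ℚ) = Wd) (hBd : BSDp Wd 2) :
    HasTwoDivisibilityUpToTorsion W K P 0 := by
  haveI : Fact (Nat.Prime 2) := ⟨Nat.prime_two⟩
  have hmod : hasEntireLFunction_rat := hasEntireLFunction_rat_of_exists_isNewformOf hnf
  have hrk : W.mordellWeilRank = 1 :=
    (mordellWeilRank_eq_one_of_analyticRank_eq_one_of_isGloballyMinimal hGZ hKo hnf hHL W hr).1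
  have hHN : SatisfiesHeegnerHypothesis (W.conductorNorm ℤ) K := satisfiesHeegnerHypothesis_of_doorAdmissible W K hK hadm
  -- the per-datum equivalence, left to right
  obtain ⟨-, -, hiff⟩ :=
    bsdp_two_iff_doorLawFullC_at_of_rank hmod doorTwistTamagawaAtTwo W hT hc hr hrk K hK (hGZ _ W K) (hKo _ W K) hadm hHN hLt
      Dt H ι P hP Wd Cd hWd hBd
  obtain ⟨m, hm, hlaw⟩ := hiff.mp hB
  -- the terms of the `Ш`-side
  have hsW : padicValNat 2 (Nat.card (AddCommGroup.primaryComponent W.sha 2)) = 0 :=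
    padicValNat_card_primaryComponent_sha_two_eq_zero_of_shaTwoTrivial W hSha
  have hD0 : (NumberField.discr K : ℚ) ≠ 0 := by exact_mod_cast NumberField.discr_ne_zero K
  obtain ⟨-, -, hbotd⟩ := twist_arith_of_selmerTrivial W hD0 hsel Wd Cd hWd
  have hsd : padicValNat 2 (Nat.card (AddCommGroup.primaryComponent Wd.sha 2)) = 0 := by
    rw [hbotd, AddSubgroup.card_bot]; simp
  have hc2 : ¬ (2 : ℤ) ∣ Dt.c := fun h => Int.not_even_iff_odd.mpr hodd (even_iff_two_dvd.mpr h)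
  rw [hsW, hsd, padicValInt.eq_zero_of_not_dvd hc2] at hlaw
  -- `2m + b = 0 + 0 + (t + 2s) + 0` with `t + 2s = b`
  have hm0 : m = 0 := by
    by_cases hΔ : W.Δ < 0
    · rw [if_pos hΔ] at hlaw hmin; omega
    · rw [if_neg hΔ] at hlaw hmin; omega
  subst hm0
  exact hm

/-- **R₀ FROM `BSD₂` ON THE FIRST-LAYER LOCUS**, modulo the four primary printed facts, the route's four rank-`0` cruxes at `2` BY NAME
(`bsdp_two_of_rankZero_cruxes` for the twin) and the reduction-type-free rank-`0` `2`-converse `hconv` (OPEN at `2`; nothing asserted): if every curve of the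
slice with `Ш(W)[2] = 0` and an odd-constant datum satisfies `BSDp W 2` (`hBcls`), then R₀ holds — at every `Sel₂`-trivial minimal door `#Sel₂(Wd) = 1` ⟹
corank `0` (`twin_selmerCorank_two_eq_zero_of_twistSelmerTwoCard_eq_one`) ⟹ (`hconv`; the twin is non-CM by `j`-invariance) `r_an(Wd) = 0` ⟹ the door is open
(`analyticRank_eq_zero_iff`, `entireLFunction_smul`) and `BSDp Wd 2`; then the previous theorem.  The sign-free form of the width seat's
`heegnerNonDivisibilityAtSelmerTrivialPrimeDoorAtTwo_of_bsdTwo_on_class_of_twoConverse`.  CONDITIONAL by design; BSD is not proved by this.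
[cite: Zhang2014CJM, Thm. 1.1] [cite: GrossZagier1986, Thm. I.6.3 and V.§2] [cite: BhargavaSkinnerZhang2014, Thm. 5 (d)] -/
theorem kolyvaginTwo_of_bsdTwo_on_class_of_twoConverse
    (hGZ : ∀ (N : ℕ) [NeZero N] (W : WeierstrassCurve ℚ) (K : Type) [Field K] [NumberField K], gross_zagier N W K)
    (hKo : ∀ (N : ℕ) [NeZero N] (W : WeierstrassCurve ℚ) (K : Type) [Field K] [NumberField K], kolyvagin N W K)
    (hnf : exists_isNewformOf) (hHL : HoffsteinLuo1997_exists_twist_L_one_ne_zero)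
    (hZ4 : GoodOrdinaryRankZeroAtTwo ∧ MultiplicativeRankZeroAtTwo ∧ SupersingularRankZeroAtTwo ∧ AdditiveRankZeroAtTwo)
    (hconv : ∀ (V : WeierstrassCurve ℚ) [V.IsElliptic] [V.IsGloballyMinimal], ¬ V.HasCM → V.selmerCorank 2 = 0 → V.analyticRank = 0)
    (hBcls : ∀ (W : WeierstrassCurve ℚ) [W.IsElliptic] [W.IsGloballyMinimal] [NeZero (W.conductorNorm ℤ)],
      ¬ W.HasCM → (∀ n : ℕ, W.HasSurjectiveModNGaloisRep ((2 ^ n : ℕ) : ℤ)) → Odd W.torsionOrder → Odd W.tamagawaProduct →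
      W.analyticRank = 1 → ShaTwoTrivial W → (∃ Dt : ModularParametrizationData W (W.conductorNorm ℤ), Odd Dt.c) → BSDp W 2) :
    HeegnerNonDivisibilityAtSelmerTrivialMinimalDoorAtTwo := by
  intro W _ _ _ hCM hsurj hT hc hr hSha K _ _ hK hadm hmin _hcop _hHN hsel Dt H ι P hP hodd
  have hB : BSDp W 2 := hBcls W hCM hsurj hT hc hr hSha ⟨Dt, hodd⟩
  have hmod : hasEntireLFunction_rat := hasEntireLFunction_rat_of_exists_isNewformOf hnf
  have hD0 : (NumberField.discr K : ℚ) ≠ 0 := by exact_mod_cast NumberField.discr_ne_zero K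
  haveI hEt : (W.quadraticTwist (NumberField.discr K : ℚ)).IsElliptic := W.isElliptic_quadraticTwist hD0
  obtain ⟨Cd, hCd⟩ := hasGlobalMinimalModel_rat_holds (W.quadraticTwist (NumberField.discr K : ℚ))
  haveI := hCd
  set Wd : WeierstrassCurve ℚ := Cd • W.quadraticTwist (NumberField.discr K : ℚ) with hWd_def
  have hWd : Cd • W.quadraticTwist (NumberField.discr K : ℚ) = Wd := rfl
  -- the twin: non-CM, corank `0`, hence (converse) analytic rank `0`: the door is open and `BSD₂(Wd)` holds
  have hCMd : ¬ Wd.HasCM := RamifiedPairUpperBound.not_hasCM_of_smul_quadraticTwist_eq hD0 hWd hCM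
  have hrd : Wd.analyticRank = 0 := hconv Wd hCMd (twin_selmerCorank_two_eq_zero_of_twistSelmerTwoCard_eq_one W hsel Wd Cd hWd)
  have hLeq : Wd.entireLFunction = (W.quadraticTwist (NumberField.discr K : ℚ)).entireLFunction := by
    rw [← hWd, entireLFunction_smul]
  have hLt : (W.quadraticTwist (NumberField.discr K : ℚ)).entireLFunction 1 ≠ 0 := by
    rw [← hLeq]
    exact (Wd.analyticRank_eq_zero_iff_holds (hmod Wd)).1 hrd
  have hBd : BSDp Wd 2 := bsdp_two_of_rankZero_cruxes hZ4 Wd hCMd hrd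
  exact hasTwoDivisibilityUpToTorsion_zero_of_bsdp_two_at_minimalDoor hGZ hKo hnf hHL W hT hc hr hSha hB K hK hadm hmin hsel hLt Dt H ι P hP
    hodd Wd Cd hWd hBd

/-- **R₀ FROM THE CRUX** (modulo the four primary printed facts, the four rank-`0` cruxes BY NAME and the rank-`0` `2`-converse `hconv`): the crux
`RankOneAtTwoBigImageOddLocal` gives `BSDp W 2` on the whole slice, in particular on the first-layer locus.  So R₀ is NOT a strengthening of the crux on its
locus: v8.17's stub is the crux's own content there, up to `hconv`.  CONDITIONAL by design; BSD is not proved by this. [cite: Zhang2014CJM, Thm. 1.1]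
[cite: GrossLMS1991, Conj. 1.2 and §10] -/
theorem kolyvaginTwo_of_rankOneAtTwoBigImageOddLocal_of_twoConverse
    (hGZ : ∀ (N : ℕ) [NeZero N] (W : WeierstrassCurve ℚ) (K : Type) [Field K] [NumberField K], gross_zagier N W K)
    (hKo : ∀ (N : ℕ) [NeZero N] (W : WeierstrassCurve ℚ) (K : Type) [Field K] [NumberField K], kolyvagin N W K)
    (hnf : exists_isNewformOf) (hHL : HoffsteinLuo1997_exists_twist_L_one_ne_zero)
    (hZ4 : GoodOrdinaryRankZeroAtTwo ∧ MultiplicativeRankZeroAtTwo ∧ SupersingularRankZeroAtTwo ∧ AdditiveRankZeroAtTwo)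
    (hconv : ∀ (V : WeierstrassCurve ℚ) [V.IsElliptic] [V.IsGloballyMinimal], ¬ V.HasCM → V.selmerCorank 2 = 0 → V.analyticRank = 0)
    (hX : RankOneAtTwoBigImageOddLocal) : HeegnerNonDivisibilityAtSelmerTrivialMinimalDoorAtTwo :=
  kolyvaginTwo_of_bsdTwo_on_class_of_twoConverse hGZ hKo hnf hHL hZ4 hconv
    (fun W _ _ _ hCM hsurj hT hc hr _ _ => hX W hCM hsurj hT hc hr)

/-- **v8.17 IS LOSSLESS modulo PRINT⁴ + rank-`0` cruxes + the rank-`0` `2`-converse: the crux gives BOTH registered residues R₀ and R₊₊.**  R₀ by the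
previous theorem; R₊₊ through the lead's chain crux ⟹ hypothesis-free residue (`doorIndexLawFullCAtTwoSomeDoor_of_rankOneAtTwoBigImageOddLocal`) ⟹ residue ⟹
R₊ ⟹ R₊₊.  With §3: crux ⟺ R₀ ∧ R₊₊ modulo those inputs.  CONDITIONAL by design; BSD is not proved by this. [cite: GrossLMS1991, Conj. 1.2, §3 and §10]
[cite: Zhang2014CJM, Thm. 1.1] -/
theorem kolyvaginTwo_and_residuePlusPlus_of_rankOneAtTwoBigImageOddLocal_of_twoConverse
    (hGZ : ∀ (N : ℕ) [NeZero N] (W : WeierstrassCurve ℚ) (K : Type) [Field K] [NumberField K], gross_zagier N W K)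
    (hKo : ∀ (N : ℕ) [NeZero N] (W : WeierstrassCurve ℚ) (K : Type) [Field K] [NumberField K], kolyvagin N W K)
    (hnf : exists_isNewformOf) (hHL : HoffsteinLuo1997_exists_twist_L_one_ne_zero)
    (hZ4 : GoodOrdinaryRankZeroAtTwo ∧ MultiplicativeRankZeroAtTwo ∧ SupersingularRankZeroAtTwo ∧ AdditiveRankZeroAtTwo)
    (hconv : ∀ (V : WeierstrassCurve ℚ) [V.IsElliptic] [V.IsGloballyMinimal], ¬ V.HasCM → V.selmerCorank 2 = 0 → V.analyticRank = 0)
    (hX : RankOneAtTwoBigImageOddLocal) :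
    HeegnerNonDivisibilityAtSelmerTrivialMinimalDoorAtTwo ∧ DoorIndexLawFullCAtTwoSomeDoorResiduePlusPlus :=
  ⟨kolyvaginTwo_of_rankOneAtTwoBigImageOddLocal_of_twoConverse hGZ hKo hnf hHL hZ4 hconv hX,
    doorIndexLawFullCAtTwoSomeDoorResiduePlusPlus_of_residuePlus
      (heegnerNonDiv_and_residuePlus_of_rankOneAtTwoBigImageOddLocal_of_twoConverse hGZ hKo hnf hHL hZ4 hconv hX).2⟩

end Summit.BirchSwinnertonDyer.BirchSwinnertonDyer.Theorems.RankOneAtTwoOneDoor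

end
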